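import Mathlib.Algebra.Order.BigOperators.Group.Finset
import Mathlib.Algebra.Order.Field.Basic
import Mathlib.Algebra.BigOperators.Ring.Finset
import Mathlib.Tactic.Linarith
import Mathlib.Tactic.Positivity
import Mathlib.Tactic.FieldSimp
import Mathlib.Tactic.Ring
import HarnessLib

/-!
# R-H round-3 AXIS D2 · D2-EXP-4 — HEIGHT SCALING of the object class «PARTIAL CREDIT»: the recovered fraction is `K/h` —
# exponent `−1` EXACTLY, by a two-sided sandwich with height-free constants (PROOF-ONLY, 0 defs)

abc-iut cell, rung LADDER-ABC:A2.RESCUE.H, round-3 axis D2 (21-frontier 11:38:40Z / 11:44:07Z, D-0127/D-0130); seat abc-iut-rh2-q3-num g4, KEY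
`wake/KEY-abc-iut-rh2-q3-num-D2-EXP-4.md` (priority8 12:14:07Z): «from the FINAL's item (1)(d) law (credit conductor-type while T ∝ h, C/R ∝ h⁻¹)
derive this class's recovered-fraction EXPONENT in h … typed statement; kernel face where decidable». Numbers of record: HOME
`abc-iut-rh2-q3-num/D2-EXP4-PARTIAL-CREDIT-v1.md` (STATUS 2026-08-27T12:31:33Z): bed fit `10⁶→10⁹` median `−1.00000` on FREY133 / HEX79 / FREY482,
constant `K` median 377 / 395 / 400 nats; this file is the KERNEL FACE of the law behind those numbers.

THE CELL TABLE UNDER HEIGHT DILATION (D0121-SPEC §1.0; topt-lp-1 ADDENDUM v1.1 (X); rh-kit-2 PASS 22b): a finite family `s` of cells `c = (w, j)`; at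
height dilation `t` the cell's DEMAND is `t·τ c` (`τ c = (j²−1)·m_q,w·u_w ≥ 0`, HEIGHT-TYPE) and its exact PRICE is `p c` with HEIGHT-FREE bounds
`a c ≤ p c ≤ b c` (`a = (j·δ_w + (j+1)·G_w)·u_w`, `b = a + (e_w − 1)·u_w`: the price `j·δ_w + (j+1)·G_w + ρ_j`, `ρ_j ∈ [0, e_w)`, is CONDUCTOR-TYPE — it depends on
`t` only through the bounded residue `ρ_j`); a cell is LICENSED iff `t·τ c ≤ p c`; the weightless cells (`τ c = 0`, the labels `j = 1`) have `0 ≤ p c`.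
The object class «PARTIAL CREDIT» (FINAL (5) rung r1 − r0 = FINAL (4) SRM identity = D0121-SPEC §1.1′ «PRICE GAIN», class INSIDE/L1) credits every
UNLICENSED cell with its price; its recovered mass is `PCmass(t) = Σ_{c : p c < t·τ c} p c` and its recovered FRACTION is `PCmass(t) / (t·Σ τ)`.
* §1 `partialCreditMass_le_sum_hi` — **(L1)** for every `t ≥ 0`: `PCmass(t) ≤ Σ_{τ>0} b` (a height-free constant); fraction form
  `partialCredit_le_hi_div` : `PCmass(t)/(t·Στ) ≤ (Σ_{τ>0} b / Στ) / t` — exponent `≤ −1`.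
* §2 BEYOND THE LAST LICENCE (`b c < t·τ c` at every cell with `τ c > 0`): `unlicensed_eq_weighted` — the unlicensed cells are EXACTLY the weighted
  ones; **(L2)** `sum_lo_le_partialCreditMass` / `partialCreditMass_le_sum_hi` : `Σ_{τ>0} a ≤ PCmass(t) ≤ Σ_{τ>0} b`; fraction form
  `lo_div_le_partialCredit` — exponent `≥ −1`; so the exponent is `−1` EXACTLY with constant in `[Σ_{τ>0} a, Σ_{τ>0} b]`, and
  `partialCredit_decay_ratio` : `t′·PC(t′) ≤ (Σb/Σa)·(t·PC(t))` for any two dilations beyond the last licence (decay at rate `1/t` up to the band).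
* §3 THE CELL-MODEL THRESHOLD `threshold_two_dominates` / `price_lt_demand_of_threshold` — at a place with integers `δ, G, e ≥ 0`, `m > 0`: if
  `2δ + 3G + e < 3·m·t` (i.e. `t` exceeds the place's `t₀ = (2δ+3G+e)/(3m)`) then EVERY label `j ≥ 2` has `j·δ + (j+1)·G + ρ < (j²−1)·m·t` for every
  residue `ρ < e` — the hypothesis of §2 holds from `t₀` on (the `j = 2` threshold dominates all larger labels), and `threshold_mono` — it persists upward.
HONEST FRAMING: elementary ordered-field algebra about a finite table of numbers; the reading «table ↔ genuine datum» is the kit certificate (rh-kit-2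
PASS 22/22b A≡B, this seat's engine = that grid on 6,248/6,248 cells; computed ≠ proved); nothing here asserts that abc is proved or refuted, or that
[IUTchIII] Cor. 3.12 / [IUTchIV] Thm. 1.10 holds or fails at any datum, or takes a side on any author; typed ≠ proved. [folklore] throughout.
-/

namespace Summit.ABC.IUTFork.Repair.RH.HeightScaling.PartialCredit

open Finset

variable {ι 𝕜 : Type*} [Field 𝕜] [LinearOrder 𝕜] [IsStrictOrderedRing 𝕜]

section Sandwich

variable {s : Finset ι} {τ p a b : ι → 𝕜} {t : 𝕜}

omit [IsStrictOrderedRing 𝕜] in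
/-- A weightless cell (`τ c = 0`, price `≥ 0`) is never unlicensed; hence every unlicensed cell is a weighted one:
`{c : p c < t·τ c} ⊆ {c : 0 < τ c}`. [folklore] -/
theorem unlicensed_subset_weighted (hτ : ∀ c ∈ s, 0 ≤ τ c) (hp0 : ∀ c ∈ s, τ c = 0 → 0 ≤ p c) :
    s.filter (fun c => p c < t * τ c) ⊆ s.filter (fun c => 0 < τ c) := by
  intro c hc
  rw [mem_filter] at hc ⊢
  refine ⟨hc.1, lt_of_le_of_ne (hτ c hc.1) ?_⟩
  intro h0
  have h := hp0 c hc.1 h0.symm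
  have : p c < 0 := by simpa [← h0] using hc.2
  exact absurd h (not_le.mpr this)

/-- **(L1) THE HEIGHT-FREE CEILING.** For every dilation `t ≥ 0` the partial-credit mass is at most the total upper price of the weighted cells:
`Σ_{c : p c < t·τ c} p c ≤ Σ_{c : 0 < τ c} b c`. (Unlicensed cells are weighted and have `p ≤ b`; a licensed weighted cell contributes
`b ≥ p ≥ t·τ ≥ 0`.) [folklore] -/
theorem partialCreditMass_le_sum_hi (hτ : ∀ c ∈ s, 0 ≤ τ c) (hp0 : ∀ c ∈ s, τ c = 0 → 0 ≤ p c)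
    (hb : ∀ c ∈ s, p c ≤ b c) (ht : 0 ≤ t) :
    ∑ c ∈ s.filter (fun c => p c < t * τ c), p c ≤ ∑ c ∈ s.filter (fun c => 0 < τ c), b c := by
  calc ∑ c ∈ s.filter (fun c => p c < t * τ c), p c
      ≤ ∑ c ∈ s.filter (fun c => p c < t * τ c), b c :=
        sum_le_sum fun c hc => hb c (mem_filter.mp hc).1
    _ ≤ ∑ c ∈ s.filter (fun c => 0 < τ c), b c := by
        refine sum_le_sum_of_subset_of_nonneg (unlicensed_subset_weighted hτ hp0) ?_
        intro c hc hnc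
        rw [mem_filter] at hc hnc
        have hlic : t * τ c ≤ p c := not_lt.mp fun h => hnc ⟨hc.1, h⟩
        have : 0 ≤ t * τ c := mul_nonneg ht (hτ c hc.1)
        linarith [hb c hc.1]

/-- **(L1), FRACTION FORM — exponent `≤ −1`.** With total demand slope `Στ > 0` and `t > 0`:
`PCmass(t) / (t·Στ) ≤ (Σ_{τ>0} b / Στ) / t` — the recovered fraction of the class is at most the height-free constant `A_hi := Σ_{τ>0} b / Στ`
divided by the dilation. [folklore] -/
theorem partialCredit_le_hi_div (hτ : ∀ c ∈ s, 0 ≤ τ c) (hp0 : ∀ c ∈ s, τ c = 0 → 0 ≤ p c)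
    (hb : ∀ c ∈ s, p c ≤ b c) (ht : 0 < t) (hM : 0 < ∑ c ∈ s, τ c) :
    (∑ c ∈ s.filter (fun c => p c < t * τ c), p c) / (t * ∑ c ∈ s, τ c)
      ≤ ((∑ c ∈ s.filter (fun c => 0 < τ c), b c) / ∑ c ∈ s, τ c) / t := by
  rw [div_div, mul_comm (∑ c ∈ s, τ c) t]
  exact div_le_div_of_nonneg_right (partialCreditMass_le_sum_hi hτ hp0 hb ht.le) (mul_pos ht hM).le

omit [IsStrictOrderedRing 𝕜] in
/-- **BEYOND THE LAST LICENCE the unlicensed cells are EXACTLY the weighted ones**: if `b c < t·τ c` at every weighted cell then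
`{c : p c < t·τ c} = {c : 0 < τ c}`. [folklore] -/
theorem unlicensed_eq_weighted (hτ : ∀ c ∈ s, 0 ≤ τ c) (hp0 : ∀ c ∈ s, τ c = 0 → 0 ≤ p c)
    (hb : ∀ c ∈ s, p c ≤ b c) (hlast : ∀ c ∈ s, 0 < τ c → b c < t * τ c) :
    s.filter (fun c => p c < t * τ c) = s.filter (fun c => 0 < τ c) := by
  refine Subset.antisymm (unlicensed_subset_weighted hτ hp0) ?_
  intro c hc
  rw [mem_filter] at hc ⊢
  exact ⟨hc.1, lt_of_le_of_lt (hb c hc.1) (hlast c hc.1 hc.2)⟩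

/-- **(L2), LOWER HALF.** Beyond the last licence the partial-credit mass is at least the total lower price of the weighted cells:
`Σ_{c : 0 < τ c} a c ≤ Σ_{c : p c < t·τ c} p c`. [folklore] -/
theorem sum_lo_le_partialCreditMass (hτ : ∀ c ∈ s, 0 ≤ τ c) (hp0 : ∀ c ∈ s, τ c = 0 → 0 ≤ p c)
    (ha : ∀ c ∈ s, a c ≤ p c) (hb : ∀ c ∈ s, p c ≤ b c) (hlast : ∀ c ∈ s, 0 < τ c → b c < t * τ c) :
    ∑ c ∈ s.filter (fun c => 0 < τ c), a c ≤ ∑ c ∈ s.filter (fun c => p c < t * τ c), p c := by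
  rw [unlicensed_eq_weighted hτ hp0 hb hlast]
  exact sum_le_sum fun c hc => ha c (mem_filter.mp hc).1

/-- **(L2), UPPER HALF** (beyond the last licence, where it is an identity of index sets): `Σ_{c : p c < t·τ c} p c ≤ Σ_{c : 0 < τ c} b c`.
[folklore] -/
theorem partialCreditMass_le_sum_hi_of_last (hτ : ∀ c ∈ s, 0 ≤ τ c) (hp0 : ∀ c ∈ s, τ c = 0 → 0 ≤ p c)
    (hb : ∀ c ∈ s, p c ≤ b c) (hlast : ∀ c ∈ s, 0 < τ c → b c < t * τ c) :
    ∑ c ∈ s.filter (fun c => p c < t * τ c), p c ≤ ∑ c ∈ s.filter (fun c => 0 < τ c), b c := by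
  rw [unlicensed_eq_weighted hτ hp0 hb hlast]
  exact sum_le_sum fun c hc => hb c (mem_filter.mp hc).1

/-- **(L2), FRACTION FORM — exponent `≥ −1`.** Beyond the last licence, with `Στ > 0` and `t > 0`:
`(Σ_{τ>0} a / Στ) / t ≤ PCmass(t) / (t·Στ)` — the recovered fraction is at least the height-free constant `A_lo := Σ_{τ>0} a / Στ` divided by the
dilation. Together with `partialCredit_le_hi_div`: `A_lo / t ≤ PC(t) ≤ A_hi / t`, i.e. the class's exponent in the height is `−1` EXACTLY. [folklore] -/
theorem lo_div_le_partialCredit (hτ : ∀ c ∈ s, 0 ≤ τ c) (hp0 : ∀ c ∈ s, τ c = 0 → 0 ≤ p c)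
    (ha : ∀ c ∈ s, a c ≤ p c) (hb : ∀ c ∈ s, p c ≤ b c) (hlast : ∀ c ∈ s, 0 < τ c → b c < t * τ c)
    (ht : 0 < t) (hM : 0 < ∑ c ∈ s, τ c) :
    ((∑ c ∈ s.filter (fun c => 0 < τ c), a c) / ∑ c ∈ s, τ c) / t
      ≤ (∑ c ∈ s.filter (fun c => p c < t * τ c), p c) / (t * ∑ c ∈ s, τ c) := by
  rw [div_div, mul_comm (∑ c ∈ s, τ c) t]
  exact div_le_div_of_nonneg_right (sum_lo_le_partialCreditMass hτ hp0 ha hb hlast) (mul_pos ht hM).le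

/-- **THE SANDWICH IN ONE LINE** (the typed law (L2) of D2-EXP4-PARTIAL-CREDIT-v1.md §2): beyond the last licence,
`Σ_{τ>0} a ≤ t·(PCmass(t)/(t·Στ))·Στ ≤ Σ_{τ>0} b` stated as the pair of mass inequalities. [folklore] -/
theorem partialCreditMass_mem_Icc (hτ : ∀ c ∈ s, 0 ≤ τ c) (hp0 : ∀ c ∈ s, τ c = 0 → 0 ≤ p c)
    (ha : ∀ c ∈ s, a c ≤ p c) (hb : ∀ c ∈ s, p c ≤ b c) (hlast : ∀ c ∈ s, 0 < τ c → b c < t * τ c) :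
    ∑ c ∈ s.filter (fun c => 0 < τ c), a c ≤ ∑ c ∈ s.filter (fun c => p c < t * τ c), p c ∧
      ∑ c ∈ s.filter (fun c => p c < t * τ c), p c ≤ ∑ c ∈ s.filter (fun c => 0 < τ c), b c :=
  ⟨sum_lo_le_partialCreditMass hτ hp0 ha hb hlast, partialCreditMass_le_sum_hi_of_last hτ hp0 hb hlast⟩

/-- **THE THRESHOLD PERSISTS UPWARD**: if the last licence is passed at `t₀` then it is passed at every `t ≥ t₀`. [folklore] -/
theorem last_licence_mono {t₀ : 𝕜} (hlast : ∀ c ∈ s, 0 < τ c → b c < t₀ * τ c) (h : t₀ ≤ t) :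
    ∀ c ∈ s, 0 < τ c → b c < t * τ c := fun c hc hτc =>
  lt_of_lt_of_le (hlast c hc hτc) (mul_le_mul_of_nonneg_right h hτc.le)

end Sandwich

section Decay

variable {s : Finset ι} {τ a b : ι → 𝕜}

/-- **DECAY AT RATE `1/t` UP TO THE BAND.** For two dilations `t, t′` both beyond the last licence, with prices `p` (at `t`) and `p′` (at `t′`) inside
the same height-free band `[a, b]` and `0 < Σ_{τ>0} a`: `PCmass′ ≤ (Σ_{τ>0} b / Σ_{τ>0} a) · PCmass` — so the recovered FRACTIONS satisfy
`PC(t′) ≤ (Σb/Σa)·(t/t′)·PC(t)`: the class loses a factor `t′/t` of height up to the constant band ratio. [folklore] -/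
theorem partialCreditMass_le_band_mul {p p' : ι → 𝕜} {t t' : 𝕜} (hτ : ∀ c ∈ s, 0 ≤ τ c)
    (hp0 : ∀ c ∈ s, τ c = 0 → 0 ≤ p c) (hp0' : ∀ c ∈ s, τ c = 0 → 0 ≤ p' c)
    (ha : ∀ c ∈ s, a c ≤ p c) (hb : ∀ c ∈ s, p c ≤ b c) (hb' : ∀ c ∈ s, p' c ≤ b c)
    (hlast : ∀ c ∈ s, 0 < τ c → b c < t * τ c) (hlast' : ∀ c ∈ s, 0 < τ c → b c < t' * τ c)
    (hA : 0 < ∑ c ∈ s.filter (fun c => 0 < τ c), a c) :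
    ∑ c ∈ s.filter (fun c => p' c < t' * τ c), p' c ≤
      ((∑ c ∈ s.filter (fun c => 0 < τ c), b c) / ∑ c ∈ s.filter (fun c => 0 < τ c), a c) *
        ∑ c ∈ s.filter (fun c => p c < t * τ c), p c := by
  have hup' := partialCreditMass_le_sum_hi_of_last hτ hp0' hb' hlast'
  have hup := partialCreditMass_le_sum_hi_of_last hτ hp0 hb hlast
  have hlo := sum_lo_le_partialCreditMass hτ hp0 ha hb hlast
  have hB : 0 ≤ ∑ c ∈ s.filter (fun c => 0 < τ c), b c := hA.le.trans (hlo.trans hup)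
  calc ∑ c ∈ s.filter (fun c => p' c < t' * τ c), p' c
      ≤ ∑ c ∈ s.filter (fun c => 0 < τ c), b c := hup'
    _ = ((∑ c ∈ s.filter (fun c => 0 < τ c), b c) / ∑ c ∈ s.filter (fun c => 0 < τ c), a c) *
          ∑ c ∈ s.filter (fun c => 0 < τ c), a c := by rw [div_mul_cancel₀ _ hA.ne']
    _ ≤ ((∑ c ∈ s.filter (fun c => 0 < τ c), b c) / ∑ c ∈ s.filter (fun c => 0 < τ c), a c) *
          ∑ c ∈ s.filter (fun c => p c < t * τ c), p c :=
        mul_le_mul_of_nonneg_left hlo (div_nonneg hB hA.le)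

end Decay

section CellModelThreshold

/-- **THE `j = 2` THRESHOLD DOMINATES.** For a label `j ≥ 2` and non-negative `δ, G, e`:
`3·(j·δ + (j+1)·G + e) ≤ (j² − 1)·(2·δ + 3·G + e)` — the per-label delicensing threshold `(jδ + (j+1)G + e)/((j²−1)m)` is largest at `j = 2`
(numerator linear, denominator quadratic in `j`). [folklore] -/
theorem threshold_two_dominates {j δ G e : 𝕜} (hj : 2 ≤ j) (hδ : 0 ≤ δ) (hG : 0 ≤ G) (he : 0 ≤ e) :
    3 * (j * δ + (j + 1) * G + e) ≤ (j ^ 2 - 1) * (2 * δ + 3 * G + e) := by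
  have h1 : 3 * j ≤ 2 * (j ^ 2 - 1) := by nlinarith
  have h2 : 3 * (j + 1) ≤ 3 * (j ^ 2 - 1) := by nlinarith
  have h3 : (3 : 𝕜) ≤ j ^ 2 - 1 := by nlinarith
  nlinarith [mul_le_mul_of_nonneg_right h1 hδ, mul_le_mul_of_nonneg_right h2 hG, mul_le_mul_of_nonneg_right h3 he]

/-- **THE CELL-MODEL THRESHOLD.** At a place with `δ, G, e ≥ 0` and local height slope `m`: if the dilation `t` exceeds the place's
`t₀ = (2δ + 3G + e)/(3m)`, i.e. `2δ + 3G + e < 3·m·t`, then for EVERY label `j ≥ 2` and every residue `0 ≤ ρ < e` the exact price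
`j·δ + (j+1)·G + ρ` is below the demand `(j²−1)·m·t`: every weighted cell of the place is unlicensed, which is hypothesis `hlast` of §2 with
`b = j·δ + (j+1)·G + e` (one more than the largest residue). [folklore] -/
theorem price_lt_demand_of_threshold {j δ G e ρ m t : 𝕜} (hj : 2 ≤ j) (hδ : 0 ≤ δ) (hG : 0 ≤ G) (he : 0 ≤ e)
    (hρ : ρ < e) (ht : 2 * δ + 3 * G + e < 3 * m * t) :
    j * δ + (j + 1) * G + ρ < (j ^ 2 - 1) * m * t := by
  have hdom := threshold_two_dominates hj hδ hG he
  have hj2 : (0 : 𝕜) < j ^ 2 - 1 := by nlinarith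
  have : 3 * (j * δ + (j + 1) * G + e) < (j ^ 2 - 1) * (3 * m * t) :=
    lt_of_le_of_lt hdom (mul_lt_mul_of_pos_left ht hj2)
  nlinarith

/-- … and in the `b`-form used by §2: `j·δ + (j+1)·G + e ≤ (j²−1)·m·t` whenever `2δ + 3G + e ≤ 3·m·t` (non-strict version). [folklore] -/
theorem bound_le_demand_of_threshold {j δ G e m t : 𝕜} (hj : 2 ≤ j) (hδ : 0 ≤ δ) (hG : 0 ≤ G) (he : 0 ≤ e)
    (ht : 2 * δ + 3 * G + e ≤ 3 * m * t) :
    j * δ + (j + 1) * G + e ≤ (j ^ 2 - 1) * m * t := by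
  have hdom := threshold_two_dominates hj hδ hG he
  have hj2 : (0 : 𝕜) ≤ j ^ 2 - 1 := by nlinarith
  have : 3 * (j * δ + (j + 1) * G + e) ≤ (j ^ 2 - 1) * (3 * m * t) :=
    le_trans hdom (mul_le_mul_of_nonneg_left ht hj2)
  nlinarith

end CellModelThreshold

end Summit.ABC.IUTFork.Repair.RH.HeightScaling.PartialCredit
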